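import Literature.NumberTheory.LFunctions.WeilBochnerRepresentationRH
import HarnessLib

/-!
# HANDOFF, FILE XII-w′: the COSINE face of the Mellin transform (even sector) — parity and reality on the critical line

HONEST FRAMING. Nothing here proves or approaches RH; nothing here even mentions it. Companion of FILE XII-w
(`HandoffMellinPinning`, §5 = the sine face for ODD tests): the EVEN wall vectors of the cell's Mellin tables
(HOME/handoff/theory-2/edgesign/REPORT.md §4m‴: E5 … E37, `F(γ) = ∫₀^b u cos(γu) du = ½∫_ℝ g cos`) are checked through
§1 `ĝ(½+iγ) = ∫ g(t) cos(γt) dt` (`weilMellin_half_add_mul_I_of_even`: the sine part dies by evenness), and for a REAL even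
test the transform is REAL on the critical line (`conj_weilMellin_half_add_mul_I_of_even`) — why `W = F/Ξ` of REPORT §4m⁗ is
a real function whose sign changes can be counted. The per-pair budget `2‖∫ g cos γt‖² ≤ Re Q(g)` under RH (mirror of XII-w's
`two_mul_norm_sq_integral_sin_le`) is a two-line corollary of XII-w §1 and is appended here once XII-w's olean is on the check
farm (it was not at this write). Unconditional; no new definitions. Seat rh-explicit-handoff-theory-2 (gen10).

References: E. Bombieri, Rend. Mat. Acc. Lincei (9) 11 (2000) Thm 2 (the transform `ĝ(s) = ∫ g(t)e^{(s−½)t}dt`) [Bombieri2000Weil].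
-/

set_option linter.dupNamespace false  -- the mandated namespace repeats `RiemannHypothesis`

noncomputable section

open Complex Set Filter MeasureTheory Literature.NumberTheory.LFunctions
open Literature.NumberTheory.LFunctions.WeilBochner
open scoped Real Topology ComplexConjugate

namespace Summit.RiemannHypothesis.RiemannHypothesis.Theorems.HandoffMellinPinningEven

variable {g : ℝ → ℂ}

/-! ## §1 The COSINE-TRANSFORM face (even sector): `ĝ(½+iγ) = ∫ g(t) cos(γt) dt`, real on the critical line for real `g`

The even wall vectors of the cell's tables (E5 … E37: `F(γ) = ∫₀^b u cos(γu) du = ½∫_ℝ g cos`) are checked through this face: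
for an EVEN test `g` the sine part of the transform dies (mirror of XII-w §5's odd/sine identity), and for a REAL even test the
value at `½ + iγ` is real. -/

/-- **Even sector: the Mellin transform on the critical line is the cosine transform.** For an even Weil test function `g`
(`g(−t) = g(t)`) and real `γ`: `ĝ(½ + iγ) = ∫ g(t) cos(γt) dt` (the sine part dies by evenness; `= 2∫₀^∞ g cos` for the cell's
half-line `F`). [cite: Bombieri2000Weil, Thm 2 (the transform `ĝ(s) = ∫ g(t)e^{(s−½)t}dt`); parity bookkeeping: this track] -/
theorem weilMellin_half_add_mul_I_of_even (hg : IsWeilTest g) (heven : ∀ t, g (-t) = g t) (γ : ℝ) :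
    weilMellin g (1 / 2 + γ * I) = ∫ t : ℝ, g t * (Real.cos (γ * t) : ℂ) := by
  unfold weilMellin
  have hexp : ∀ t : ℝ, cexp ((1 / 2 + (γ : ℂ) * I - 1 / 2) * (t : ℂ)) =
      (Real.cos (γ * t) : ℂ) + (Real.sin (γ * t) : ℂ) * I := by
    intro t
    have : (1 / 2 + (γ : ℂ) * I - 1 / 2) * (t : ℂ) = ((γ * t : ℝ) : ℂ) * I := by push_cast; ring
    rw [this, Complex.exp_mul_I, ← Complex.ofReal_cos, ← Complex.ofReal_sin]
  have hcont : Continuous g := hg.1.continuous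
  have hci : ∀ (φ : ℝ → ℂ), Continuous φ → Integrable (fun t ↦ g t * φ t) := fun φ hφ ↦
    (hcont.mul hφ).integrable_of_hasCompactSupport (hg.2.mul_right)
  have hcosI : Integrable (fun t : ℝ ↦ g t * (Real.cos (γ * t) : ℂ)) :=
    hci _ (Complex.continuous_ofReal.comp (Real.continuous_cos.comp (continuous_const.mul continuous_id)))
  have hsinI : Integrable (fun t : ℝ ↦ g t * ((Real.sin (γ * t) : ℂ) * I)) :=
    hci _ ((Complex.continuous_ofReal.comp (Real.continuous_sin.comp (continuous_const.mul continuous_id))).mul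
      continuous_const)
  have hsplit : (fun t : ℝ ↦ g t * cexp ((1 / 2 + (γ : ℂ) * I - 1 / 2) * (t : ℂ))) =
      fun t ↦ g t * (Real.cos (γ * t) : ℂ) + g t * ((Real.sin (γ * t) : ℂ) * I) := by
    funext t; rw [hexp t]; ring
  rw [hsplit, integral_add hcosI hsinI]
  -- the sine part is odd, hence vanishes
  have hsin0 : ∫ t : ℝ, g t * ((Real.sin (γ * t) : ℂ) * I) = 0 := by
    set h : ℝ → ℂ := fun t ↦ g t * ((Real.sin (γ * t) : ℂ) * I) with hh
    have hodd' : ∀ t, h (-t) = -h t := fun t ↦ by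
      have : Real.sin (γ * -t) = -Real.sin (γ * t) := by rw [mul_neg, Real.sin_neg]
      simp only [hh, heven, this, Complex.ofReal_neg]; ring
    have h1 : ∫ t, h (-t) = ∫ t, h t := integral_neg_eq_self h volume
    have h2 : ∫ t, h (-t) = -∫ t, h t := by
      rw [← integral_neg]; exact integral_congr_ae (Filter.Eventually.of_forall fun t ↦ hodd' t)
    have h3 : ∫ t, h t = -∫ t, h t := h1.symm.trans h2
    linear_combination h3 / 2
  rw [hsin0, add_zero]

/-- **Real even tests have a REAL transform on the critical line**: `ĝ(½+iγ) = conj ĝ(½+iγ)` — since `½+iγ` and its conjugate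
`½−iγ` give conjugate values (`weilMellin_conj_of_real`) and the cosine face is even in `γ`. This is why `W = F/Ξ` of the even
wall vectors is a real function (REPORT §4m⁗). [folklore; this track] -/
theorem conj_weilMellin_half_add_mul_I_of_even (hg : IsWeilTest g) (heven : ∀ t, g (-t) = g t)
    (hreal : ∀ t, conj (g t) = g t) (γ : ℝ) :
    conj (weilMellin g (1 / 2 + γ * I)) = weilMellin g (1 / 2 + γ * I) := by
  -- `ĝ(s̄) = conj ĝ(s)` for real `g` (XII-w's `weilMellin_conj_of_real`, inlined: XII-w's olean is not yet on the check farm)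
  have hconj : ∀ s : ℂ, weilMellin g (conj s) = conj (weilMellin g s) := fun s ↦ by
    unfold weilMellin
    rw [← integral_conj]
    refine integral_congr_ae (Filter.Eventually.of_forall fun t ↦ ?_)
    show g t * cexp ((conj s - 1 / 2) * (t : ℂ)) = conj (g t * cexp ((s - 1 / 2) * (t : ℂ)))
    rw [map_mul, hreal t, ← Complex.exp_conj, map_mul, map_sub, Complex.conj_ofReal, map_div₀, map_one, map_ofNat]
  rw [← hconj]
  have hc : conj (1 / 2 + (γ : ℂ) * I) = 1 / 2 + ((-γ : ℝ) : ℂ) * I := by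
    simp only [map_add, map_div₀, map_one, map_ofNat, map_mul, Complex.conj_ofReal, Complex.conj_I, Complex.ofReal_neg]
    ring
  rw [hc, weilMellin_half_add_mul_I_of_even hg heven, weilMellin_half_add_mul_I_of_even hg heven]
  refine integral_congr_ae (Filter.Eventually.of_forall fun t ↦ ?_)
  show g t * (Real.cos (-γ * t) : ℂ) = g t * (Real.cos (γ * t) : ℂ)
  rw [neg_mul, Real.cos_neg]

end Summit.RiemannHypothesis.RiemannHypothesis.Theorems.HandoffMellinPinningEven

end
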